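import Summits.QuantumFields.BalabanUV.T4Continuum.Spine.NE9.TowerCarriersBox
import Summits.QuantumFields.BalabanUV.T4Continuum.Spine.NE9.TowerCarriersWitness

/-!
# T⁴ programme, spine estimate NE9 — NON-VACUITY AND STRICTNESS RIDER to census row C29 (`Spine/NE9/TowerCarriersBox`): the binders of the
# analytic branch along the tower (tower-NE5 over the t-box ∧ relative-disc coupling holomorphy at every level ∧ prefix dependence) are
# jointly inhabited by a NON-CONSTANT tower on which `summable_delta_of_analyticBranch` FIRES, and that same tower, read in the g-currency,
# VIOLATES gen 4's g-form `TowerCarriers.TowerNE9 … (Window γ)` for EVERY moduli family — so C29's route is not subsumed by C27's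
# (cell `pub-balaban-gaps`, seat ne9, gen 5)

Cell `pub-balaban-gaps` (YM blitz G2, seat ne9, unit `pub-balaban-gaps-ne9-g5`; record `run/shared/lean/pub/pub-balaban-gaps/ne/NE9.md` §5 row C29).
Summits-side bookkeeping on the one-domain toy tower of gen 4 (`TowerCarriersWitness.toyTower`, `toyE a φ k = linTower a φ k` — the linear Markov
tower of row C28) with the VERTEX OSCILLATION `vertexOsc t = cos(log t)` as creation function (the scalar of the NE9 owner lineage's no-go model
`T4CouplingAnalyticity.vertexModel`, here read in `t = 1∕g²` and fed through the contracting channel so that tower-NE5 holds):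
* §1 `vertexOsc`, `abs_vertexOsc_le` (`≤ 1` on ℝ), `linTower_congr` (prefix dependence of the linear tower), `linTower_update` (changing one
  coupling changes the tower by `a^{k−1−i}·(φ s − φ t_i)`), `abs_linTower_le` (`|φ| ≤ C`, `0 ≤ a < 1` ⇒ `|linTower| ≤ C∕(1−a)`).
* §2 THE BINDERS OF C29 HOLD: `towerNE5On_vertexToy` (`TowerNE5On toyTower (toyE a vertexOsc) [t₀,∞[ κ a 1`, any `0 ≤ a`),
  `prefix_vertexToy`, **`couplingAnalyticRel_vertexToy`** (`0 < t₀`, `c < 1`, `0 ≤ a < 1` ⇒ `CouplingAnalyticRel [t₀,∞[ (toyE a vertexOsc k) κ M c`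
  at EVERY level with ONE bound `M = 1∕(1−a) + 1 + e^π`: the relative discs `|z − s| ≤ c·s`, `s ≥ t₀ > 0`, lie in `Re z > 0`, where `cos ∘ log` is
  holomorphic with `‖cos(log z)‖ ≤ e^π` — the owner lineage's `norm_cos_le_exp_pi` BY NAME).
* §3 THE END FIRES: **`summable_delta_vertexToy`** = `TowerCarriersBox.summable_delta_of_analyticBranch_geometric` on these data (node U2's record
  profile `C·θ′^i`): the hypotheses of C29 are jointly satisfiable with every inequality non-trivial (`vertexToy_nonconstant`).
* §4 STRICTNESS: **`not_towerNE9_gForm_vertexToy`** — the same tower READ IN THE g-CURRENCY (`t_i = 1∕g_i²`) violates gen 4's `TowerNE9 toyTower …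
  γ κ Λ` on `Window γ` for EVERY `γ > 0` and EVERY `Λ` (level 1: `cos(2 log g₀)` takes the values `±1` at `g₀ = e^{−πn}`, `e^{−πn−π∕2}`, which are
  `e^{−πn}`-close) — the vertex obstruction of `T4CouplingAnalyticity.vertexModel_not_ne9` transplanted onto a tower obeying tower-NE5.  So the
  g-form route of C27 (`TowerCarriers.summable_delta_of_tower_growing`) does NOT apply to this tower while C29's t-currency analytic branch does:
  at shape level C29 is STRICTLY wider, exactly by the vertex.
HONEST FRAMING: a toy; nothing of Bałaban's; NE5∕NE9 NOT PRINTED ∕ NOT PROVED; spine 0∕9; instance 0∕1; one finite T⁴ — NOT ℝ⁴, NOT mass gap,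
NOT Clay.  HONEST DEPENDENCY: continuum YM on T⁴ ⇐ BetaPertH ∧ nine spine estimates (0∕9 proved); BetaPertH ⇐ (D1) ∧ (D4) ∧ CAP+tail.
-/

namespace Summit.QuantumFields.BalabanUV.T4Continuum.NE9.TowerCarriersBoxWitness

open scoped BigOperators
open Finset Filter Topology
open Literature.MathematicalPhysics.QuantumFieldTheory.Balaban1983to89
open Literature.MathematicalPhysics.QuantumFieldTheory.Balaban1983to89.T4OutputRate
open Literature.MathematicalPhysics.QuantumFieldTheory.Balaban1983to89.T4CouplingAnalyticity
  (BoxWindow CouplingAnalyticRel norm_cos_le_exp_pi)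
open T4CauchySum (delta)
open Summit.QuantumFields.BalabanUV.T4Continuum.NE9.TowerCarriers
open Summit.QuantumFields.BalabanUV.T4Continuum.NE9.TowerRateRelocation
open Summit.QuantumFields.BalabanUV.T4Continuum.NE9.TowerCarriersWitness (toyTower toyE)
open Summit.QuantumFields.BalabanUV.T4Continuum.NE9.TowerCarriersBox

/-! ## §1 The vertex oscillation and three facts about the linear tower -/

/-- THE VERTEX OSCILLATION in the t-currency: `cos(log t)` (`= cos(2 log g)` at `t = 1∕g²`) — bounded, smooth on `]0,∞[`, holomorphic and
bounded on every relative disc, with UNBOUNDED frequency at the vertex `g → 0` (`t → ∞`). [folklore] -/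
noncomputable def vertexOsc (t : ℝ) : ℝ := Real.cos (Real.log t)

/-- `|cos(log t)| ≤ 1`. [folklore] -/
theorem abs_vertexOsc_le (t : ℝ) : |vertexOsc t| ≤ 1 := Real.abs_cos_le_one _

variable {a : ℝ} {φ : ℝ → ℝ}

/-- PREFIX DEPENDENCE of the linear tower: level `k` reads the coordinates `< k` only. [folklore] -/
theorem linTower_congr (k : ℕ) {g g' : ℕ → ℝ} (h : ∀ i < k, g i = g' i) : linTower a φ k g = linTower a φ k g' := by
  unfold linTower
  exact sum_congr rfl fun i hi => by rw [h i (mem_range.mp hi)]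

/-- CHANGING ONE COUPLING: for `i < k`, `linTower k (g[i := s]) = linTower k g + a^{k−1−i}·(φ s − φ (g i))`. [folklore] -/
theorem linTower_update {k i : ℕ} (hi : i < k) (g : ℕ → ℝ) (s : ℝ) :
    linTower a φ k (Function.update g i s) = linTower a φ k g + a ^ (k - 1 - i) * (φ s - φ (g i)) := by
  unfold linTower
  rw [mul_sub, ← sub_eq_iff_eq_add', ← sum_sub_distrib]
  rw [sum_eq_single i (fun j _ hj => by rw [Function.update_of_ne hj, sub_self])
    (fun h => absurd (mem_range.mpr hi) h)]
  rw [Function.update_self]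

/-- SIZE of the linear tower: `|φ| ≤ C` everywhere and `0 ≤ a < 1` ⇒ `|linTower a φ k g| ≤ C∕(1−a)`. [folklore] -/
theorem abs_linTower_le {C : ℝ} (ha0 : 0 ≤ a) (ha1 : a < 1) (hφ : ∀ x, |φ x| ≤ C) (k : ℕ) (g : ℕ → ℝ) :
    |linTower a φ k g| ≤ C / (1 - a) := by
  have hC : 0 ≤ C := (abs_nonneg _).trans (hφ 0)
  have h1a : 0 < 1 - a := by linarith
  induction k with
  | zero =>
    rw [linTower_zero, abs_zero]
    positivity
  | succ k ih =>
    rw [linTower_succ]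
    calc |a * linTower a φ k g + φ (g k)| ≤ |a * linTower a φ k g| + |φ (g k)| := abs_add_le _ _
      _ ≤ a * (C / (1 - a)) + C := by
          rw [abs_mul, abs_of_nonneg ha0]
          exact add_le_add (mul_le_mul_of_nonneg_left ih ha0) (hφ _)
      _ = C / (1 - a) := by
          field_simp
          ring

/-! ## §2 The binders of C29 hold on the vertex toy -/

/-- **TOWER-NE5 OVER THE t-BOX HOLDS** for the vertex toy, any `0 ≤ a`, rate `θ = a`, `C₅ = 1` (the tower difference is `a^k·cos(log b)`,
`TowerRateRelocation.towerDiff_eq`). [folklore] -/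
theorem towerNE5On_vertexToy {t₀ κ : ℝ} (ha0 : 0 ≤ a) :
    TowerNE5On toyTower (toyE a vertexOsc) (Set.Ici t₀) κ a 1 := by
  intro k b _ g _ U X
  show |linTower a vertexOsc k g - linTower a vertexOsc (k + 1) (prepend b g)| ≤ 1 * a ^ (k - 0) * Real.exp (-(κ * 0))
  have h := towerDiff_eq (a := a) (φ := vertexOsc) k (prepend b g)
  have e : (fun i => prepend b g (i + 1)) = g := funext fun i => rfl
  rw [e, prepend_zero] at h
  rw [abs_sub_comm, h, Nat.sub_zero, mul_zero, neg_zero, Real.exp_zero, mul_one, one_mul, abs_mul,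
    abs_of_nonneg (pow_nonneg ha0 k)]
  calc a ^ k * |vertexOsc b| ≤ a ^ k * 1 := mul_le_mul_of_nonneg_left (abs_vertexOsc_le b) (pow_nonneg ha0 k)
    _ = a ^ k := mul_one _

/-- **PREFIX DEPENDENCE HOLDS** for the toy at every level, on any window. [folklore] -/
theorem prefix_vertexToy (W : Set (ℕ → ℝ)) (k : ℕ) :
    PrefixDependenceOn (C := toyTower.level k) (toyE a φ k) W := by
  intro g _ g' _ U X hagree
  show linTower a φ k g = linTower a φ k g'
  exact linTower_congr k fun i hi => hagree i (by show i < k - 0; omega)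

/-- **RELATIVE-DISC COUPLING HOLOMORPHY HOLDS AT EVERY LEVEL WITH ONE BOUND** `M = 1∕(1−a) + 1 + e^π` (`0 < t₀`, `c < 1`, `0 ≤ a < 1`): in the
young coupling `t_i` (`i < k`) the level-`k` toy term extends to `z ↦ linTower k t − a^{k−1−i}cos(log t_i) + a^{k−1−i}cos(log z)`, holomorphic on
`Re z > 0 ⊇` every relative disc `|z − s| ≤ c·s` (`s ≥ t₀`), bounded there by `M` (`norm_cos_le_exp_pi` BY NAME). [folklore] -/
theorem couplingAnalyticRel_vertexToy {t₀ κ c : ℝ} (ht₀ : 0 < t₀) (hc : c < 1) (ha0 : 0 ≤ a) (ha1 : a < 1) (k : ℕ) :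
    CouplingAnalyticRel (C := toyTower.level k) (Set.Ici t₀) (toyE a vertexOsc k) κ
      (1 / (1 - a) + 1 + Real.exp Real.pi) c := by
  intro U X t _ i hi
  have hik : i < k := by revert hi; show i < k - 0 → i < k; omega
  have hpow1 : a ^ (k - 1 - i) ≤ 1 := pow_le_one₀ ha0 ha1.le
  set A : ℝ := linTower a vertexOsc k t - a ^ (k - 1 - i) * vertexOsc (t i) with hA
  refine ⟨fun z => (A : ℂ) + (a : ℂ) ^ (k - 1 - i) * Complex.cos (Complex.log z), {z | 0 < z.re}, ?_, ?_, ?_, ?_⟩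
  · intro z hz
    exact ((((Complex.differentiableAt_log (Or.inl hz)).ccos).const_mul _).const_add _).differentiableWithinAt
  · intro z _
    show ‖(A : ℂ) + (a : ℂ) ^ (k - 1 - i) * Complex.cos (Complex.log z)‖ ≤
      (1 / (1 - a) + 1 + Real.exp Real.pi) * Real.exp (-(κ * 0))
    rw [mul_zero, neg_zero, Real.exp_zero, mul_one]
    have hA' : ‖(A : ℂ)‖ ≤ 1 / (1 - a) + 1 := by
      rw [Complex.norm_real, Real.norm_eq_abs, hA]
      calc |linTower a vertexOsc k t - a ^ (k - 1 - i) * vertexOsc (t i)|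
          ≤ |linTower a vertexOsc k t| + |a ^ (k - 1 - i) * vertexOsc (t i)| := abs_sub _ _
        _ ≤ 1 / (1 - a) + 1 := by
            refine add_le_add (abs_linTower_le ha0 ha1 abs_vertexOsc_le k t) ?_
            rw [abs_mul, abs_of_nonneg (pow_nonneg ha0 _)]
            calc a ^ (k - 1 - i) * |vertexOsc (t i)| ≤ 1 * 1 :=
                mul_le_mul hpow1 (abs_vertexOsc_le _) (abs_nonneg _) zero_le_one
              _ = 1 := one_mul _
    have hB : ‖(a : ℂ) ^ (k - 1 - i) * Complex.cos (Complex.log z)‖ ≤ Real.exp Real.pi := by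
      rw [norm_mul, norm_pow, Complex.norm_real, Real.norm_eq_abs, abs_of_nonneg ha0]
      calc a ^ (k - 1 - i) * ‖Complex.cos (Complex.log z)‖ ≤ 1 * Real.exp Real.pi :=
          mul_le_mul hpow1 (norm_cos_le_exp_pi (by rw [Complex.log_im]; exact Complex.abs_arg_le_pi _))
            (norm_nonneg _) zero_le_one
        _ = Real.exp Real.pi := one_mul _
    exact (norm_add_le _ _).trans (add_le_add hA' hB)
  · intro s hs z hz
    have hs0 : 0 < s := lt_of_lt_of_le ht₀ hs
    rw [Metric.mem_closedBall, dist_eq_norm, abs_of_pos hs0] at hz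
    show 0 < z.re
    have hre : ((s : ℂ) - z).re ≤ c * s := (Complex.re_le_norm _).trans (by rwa [norm_sub_rev])
    have hre' : ((s : ℂ) - z).re = s - z.re := by simp
    nlinarith
  · intro s hs
    have hs0 : 0 < s := lt_of_lt_of_le ht₀ hs
    show (A : ℂ) + (a : ℂ) ^ (k - 1 - i) * Complex.cos (Complex.log s) =
      ((linTower a vertexOsc k (Function.update t i s) : ℝ) : ℂ)
    rw [linTower_update hik, hA, ← Complex.ofReal_log hs0.le, ← Complex.ofReal_cos]
    unfold vertexOsc
    push_cast
    ring

/-- The vertex toy is NON-CONSTANT in its couplings (level 1: `cos(log 1) = 1 ≠ cos(log e^π) = −1`). [folklore] -/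
theorem vertexToy_nonconstant (U : toyTower.B) (X : toyTower.Dom) :
    toyE a vertexOsc 1 (fun _ => 1) U X ≠ toyE a vertexOsc 1 (fun _ => Real.exp Real.pi) U X := by
  refine TowerCarriersWitness.toyE_nonconstant ?_ U X
  unfold vertexOsc
  rw [Real.log_one, Real.cos_zero, Real.log_exp, Real.cos_pi]
  norm_num

/-! ## §3 The END of C29 fires on the vertex toy -/

/-- **NON-VACUITY OF ROW C29.**  `0 < t₀`, `0 < c < 1`, `0 ≤ a < 1`, `0 ≤ κ`, node U2's record profile `Cθ·θ′^i` (`0 ≤ Cθ`, `0 ≤ θ′ < 1`):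
`TowerCarriersBox.summable_delta_of_analyticBranch_geometric` applies to `toyTower`, `toyE a vertexOsc` over the t-box `[t₀,∞[` with `θ = a`,
`C₅ = 1`, `M = 1∕(1−a) + 1 + e^π` — a cutoff-independent injection dominating every t-currency coupling bracket of the toy at every run, with
`Summable (T4CauchySum.delta E₀ ρ inj)`.  Every binder discharged, none vacuously (`vertexToy_nonconstant`). [folklore] -/
theorem summable_delta_vertexToy {t₀ κ c Cθ θ' : ℝ} (ht₀ : 0 < t₀) (hc0 : 0 < c) (hc1 : c < 1) (ha0 : 0 ≤ a) (ha1 : a < 1)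
    (hκ : 0 ≤ κ) (hCθ : 0 ≤ Cθ) (hθ'0 : 0 ≤ θ') (hθ'1 : θ' < 1) {E₀ ρ : ℝ} (hE : 0 ≤ E₀) (hρ : 0 ≤ ρ) (hρ1 : ρ < 1) :
    let inj : ℕ → ℕ → ℝ := fun _ j =>
      2 * 1 * a ^ (j / 2) / (1 - a) +
        4 * (1 / (1 - a) + 1 + Real.exp Real.pi) / (c * t₀) * ∑ i ∈ Ico (j / 2) j, Cθ * θ' ^ i
    (∀ (K k : ℕ) (U : toyTower.B) (X : toyTower.Dom), toyTower.r X ≤ k →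
        ∀ t ∈ BoxWindow (Set.Ici t₀), ∀ t' ∈ BoxWindow (Set.Ici t₀), (∀ i, |t i - t' i| ≤ Cθ * θ' ^ i) →
          |toyE a vertexOsc k t U X - toyE a vertexOsc k t' U X| ≤ inj K (k - toyTower.r X)) ∧
      Summable (delta E₀ ρ inj) :=
  summable_delta_of_analyticBranch_geometric toyTower ht₀ hc0
    (by have : 0 < 1 - a := by linarith
        positivity)
    zero_le_one ha0 ha1 hκ hCθ hθ'0 hθ'1 (towerNE5On_vertexToy ha0) (prefix_vertexToy _)
    (couplingAnalyticRel_vertexToy ht₀ hc1 ha0 ha1) hE hρ hρ1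

/-! ## §4 Strictness: the same tower, read in g, violates the g-form tower-NE9 of C27 for every moduli family -/

/-- `1∕(e^{y})² = e^{−2y}`. [folklore] -/
theorem one_div_exp_sq (y : ℝ) : 1 / Real.exp y ^ 2 = Real.exp (-(2 * y)) := by
  rw [Real.exp_neg, one_div, ← Real.exp_nat_mul]
  norm_num

/-- **THE g-FORM FAILS ON THE VERTEX TOY.**  Read in the g-currency (`t_i = 1∕g_i²`), the vertex toy violates gen 4's
`TowerCarriers.TowerNE9 toyTower … γ κ Λ` on `Window γ` for EVERY `γ > 0`, EVERY `a`, EVERY `κ` and EVERY moduli family `Λ`: at level `1` the term is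
`cos(log g₀⁻²) = cos(2·log g₀⁻¹)`, equal to `1` at `g₀ = e^{−πn}` and to `−1` at `g₀ = e^{−πn−π∕2}`, two admissible values at distance `≤ e^{−πn} → 0`
— while `TowerNE9` would give `2 ≤ |Λ 1 0|·e^{−πn}`.  (The vertex obstruction of `T4CouplingAnalyticity.vertexModel_not_ne9` on a tower obeying
tower-NE5: C27's g-form END does not apply here, C29's t-currency analytic branch does — `summable_delta_vertexToy`.) [folklore] -/
theorem not_towerNE9_gForm_vertexToy {γ : ℝ} (hγ : 0 < γ) (a κ : ℝ) (Λ : ℕ → ℕ → ℝ) :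
    ¬ TowerNE9 toyTower (fun k g U X => toyE a vertexOsc k (fun i => 1 / (g i) ^ 2) U X) γ κ Λ := by
  intro h9
  -- the two admissible level-1 histories at depth `n`
  have key : ∀ n : ℕ, Real.exp (-(Real.pi * n)) ≤ γ → (2 : ℝ) ≤ |Λ 1 0| * Real.exp (-(Real.pi * n)) := by
    intro n hn
    set y : ℝ := -(Real.pi * n) with hy
    set y' : ℝ := -(Real.pi * n) - Real.pi / 2 with hy'
    have hyy' : y' ≤ y := by rw [hy, hy']; linarith [Real.pi_pos]
    set g : ℕ → ℝ := fun _ => Real.exp y with hgdef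
    set g' : ℕ → ℝ := fun i => if i = 0 then Real.exp y' else Real.exp y with hg'def
    have hg : g ∈ Window γ := fun _ => ⟨Real.exp_pos _, hn⟩
    have hg' : g' ∈ Window γ := by
      intro i
      by_cases hi : i = 0
      · simp only [hg'def, hi, if_true]
        exact ⟨Real.exp_pos _, (Real.exp_le_exp.mpr hyy').trans hn⟩
      · simp only [hg'def, hi, if_false]
        exact ⟨Real.exp_pos _, hn⟩
    have h : |toyE a vertexOsc 1 (fun i => 1 / (g i) ^ 2) () () - toyE a vertexOsc 1 (fun i => 1 / (g' i) ^ 2) () ()| ≤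
        Real.exp (-(κ * 0)) * ∑ i ∈ range (1 - 0), Λ (1 - 0) i * |g i - g' i| :=
      h9 1 g hg g' hg' () ()
    -- unfold the level-1 statement on the one-domain tower
    have e1 : ∀ h : ℕ → ℝ, toyE a vertexOsc 1 (fun i => 1 / (h i) ^ 2) () () = vertexOsc (1 / (h 0) ^ 2) := by
      intro h
      show linTower a vertexOsc 1 (fun i => 1 / (h i) ^ 2) = _
      rw [show (1 : ℕ) = 0 + 1 from rfl, linTower_succ, linTower_zero, mul_zero, zero_add]
    have hg0 : g 0 = Real.exp y := by simp [hgdef]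
    have hg'0 : g' 0 = Real.exp y' := by simp [hg'def]
    have hval : toyE a vertexOsc 1 (fun i => 1 / (g i) ^ 2) () () = 1 := by
      rw [e1, hg0, one_div_exp_sq, vertexOsc, Real.log_exp, hy,
        show -(2 * -(Real.pi * (n : ℝ))) = n * (2 * Real.pi) by ring, Real.cos_nat_mul_two_pi]
    have hval' : toyE a vertexOsc 1 (fun i => 1 / (g' i) ^ 2) () () = -1 := by
      rw [e1, hg'0, one_div_exp_sq, vertexOsc, Real.log_exp, hy',
        show -(2 * (-(Real.pi * (n : ℝ)) - Real.pi / 2)) = n * (2 * Real.pi) + Real.pi by ring,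
        Real.cos_nat_mul_two_pi_add_pi]
    rw [hval, hval', mul_zero, neg_zero, Real.exp_zero, one_mul, Nat.sub_zero, sum_range_one, hg0, hg'0] at h
    have hlhs : |(1 : ℝ) - -1| = 2 := by norm_num
    rw [hlhs] at h
    have hdiff : |Real.exp y - Real.exp y'| ≤ Real.exp y := by
      rw [abs_of_nonneg (by linarith [Real.exp_le_exp.mpr hyy'])]
      linarith [Real.exp_pos y']
    calc (2 : ℝ) ≤ Λ 1 0 * |Real.exp y - Real.exp y'| := h
      _ ≤ |Λ 1 0| * |Real.exp y - Real.exp y'| :=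
          mul_le_mul_of_nonneg_right (le_abs_self _) (abs_nonneg _)
      _ ≤ |Λ 1 0| * Real.exp y := mul_le_mul_of_nonneg_left hdiff (abs_nonneg _)
  -- but `|Λ 1 0|·e^{−πn} → 0` and `e^{−πn} → 0 ≤ γ` eventually
  have hq0 : 0 ≤ Real.exp (-Real.pi) := (Real.exp_pos _).le
  have hq1 : Real.exp (-Real.pi) < 1 := Real.exp_lt_one_iff.mpr (by linarith [Real.pi_pos])
  have hexp : ∀ n : ℕ, Real.exp (-(Real.pi * n)) = Real.exp (-Real.pi) ^ n := fun n => by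
    rw [← Real.exp_nat_mul]; ring_nf
  have ht0 : Tendsto (fun n : ℕ => Real.exp (-(Real.pi * n))) atTop (𝓝 0) := by
    simpa [hexp] using tendsto_pow_atTop_nhds_zero_of_lt_one hq0 hq1
  have ht1 : Tendsto (fun n : ℕ => |Λ 1 0| * Real.exp (-(Real.pi * n))) atTop (𝓝 0) := by
    simpa using ht0.const_mul |Λ 1 0|
  obtain ⟨n, hn1, hn2⟩ := ((ht0.eventually (Iic_mem_nhds hγ)).and (ht1.eventually (Iio_mem_nhds two_pos))).exists
  exact absurd (key n hn1) (not_le.mpr hn2)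

end Summit.QuantumFields.BalabanUV.T4Continuum.NE9.TowerCarriersBoxWitness
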